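import Mathlib
import Summits.QuantumFields.YangMills.Theses.IsotropyFromPowerCounting
import Summits.QuantumFields.YangMills.Theorems.CurvatureSandwichBound.Negative.Unbundled
import Summits.QuantumFields.YangMills.Theorems.CurvatureSandwichBound.Negative.Inhabitants
import Summits.QuantumFields.YangMills.Theorems.MirrorModularBoostsPlanarSpectralCone
import Summits.QuantumFields.YangMills.Theorems.IsotropyFromPowerCountingCurvatureSandwichBoundIterSchwarz
import Summits.QuantumFields.YangMills.Theorems.IsotropyFromPowerCountingCurvatureSandwichBoundChainOrdered
import Summits.QuantumFields.YangMills.Theorems.IsotropyFromPowerCountingCurvatureSandwichBoundSandwichAdjoint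
import Summits.QuantumFields.YangMills.Theorems.IsotropyFromPowerCountingCurvatureSandwichBoundChainEngine
import Summits.QuantumFields.YangMills.Theorems.IsotropyFromPowerCountingCurvatureSandwichBoundChainGrowthIff
import Summits.QuantumFields.YangMills.Theorems.IsotropyFromPowerCountingCurvatureSandwichBoundSumEngine
import Summits.QuantumFields.YangMills.Theorems.IsotropyFromPowerCountingCurvatureSandwichBoundDescent
import Summits.QuantumFields.YangMills.Theorems.IsotropyFromPowerCountingCurvatureSandwichBoundTiltedChainReading
import Summits.QuantumFields.YangMills.Theorems.IsotropyFromPowerCountingCurvatureSandwichBoundGeneralWindow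
import Summits.QuantumFields.YangMills.Theorems.IsotropyFromPowerCountingCurvatureSandwichBoundTiltedStep
import Summits.QuantumFields.YangMills.Theorems.IsotropyFromPowerCountingCurvatureSandwichBoundNarrowReduction
import Summits.QuantumFields.YangMills.Theorems.IsotropyFromPowerCountingCurvatureSandwichBoundDiagOfAxis

/-!
# Line `Sketch` — checked skeleton v4 (FINAL FORM) for crux `IsotropyFromPowerCounting.CurvatureSandwichBound`
(stmt-QuantumFields-18372; continuation lead prover-line-stmt-QuantumFields-18372-c1-0, 2026-08-17)

v3 (previous lead) reduced the crux LOSSLESSLY to two Yang–Mills inputs, the normalised chain-growth bounds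
`stub_chainGrowthAxis` (e₀ frame) and `stub_chainGrowthDiag` (45° frame), over the landed engine
(`sandwich_of_chainGrowth` p146381, equivalence p146704).

v4 (this lead) REMOVED THE 45° INPUT, model-blindly: the frame transfer
`sandwichRows_quarterTurn_of_sandwichRows : OSPackage S₁ → Translations S₁ → SandwichRows S₁ → IsQuarterTurnFrame R →
SandwichRows (S₁ ∘ R)` is LANDED (p166596, `Theorems/IsotropyFromPowerCountingCurvatureSandwichBoundDiagOfAxis.lean`),
composed of six landed model-blind stubs — `stub_generalWindow` p165820, `stub_tiltedStep` p166106,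
`stub_tiltedChainReading` p165469, `stub_sumEngine` p165021, `stub_descent` p165092, `stub_narrowReduction` p166236 —
and the landed density of strict cone chains (`PositivityDiscToOperatorCone.stub_density`, crux 9664) applied to
`S₁ ∘ R` (idea card `diagonal-row-from-axis-chain`): a 45°-frame sandwich chain with x₁'-narrow insertions and
strict-cone-chain ends, read in the e₀ frame of `S₁`, is an e₀-time-ordered product of e₀-windowed product-form
insertions between two e₀ field vectors, which the axis row bounds geometrically at the pair scale with the same `μ`.
Corollary (landed, same file): `curvatureSandwichBound_iff_axisRows` — THE CRUX IS EQUIVALENT TO ITS AXIS ROW.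

REGISTERED (sorry-backed) STUB, v4 final: `stub_chainGrowthAxis` ONLY — the Yang–Mills input, ⟺ the e₀ row of the item,
⟺ (by the corollary) the whole item.  All other stubs below are one-line aliases of landed theorems; `stub_chainGrowthDiag`
is derived in this file.
-/

noncomputable section

namespace Summit.QuantumFields.YangMills.Cruxes.CurvatureSandwichBound.Sketch

open scoped BigOperators SchwartzMap InnerProductSpace
open MeasureTheory Filter Topology
open Literature.MathematicalPhysics.QuantumLattice Literature.MathematicalPhysics.AQFT
  Literature.MathematicalPhysics.QuantumFieldTheory Literature.Probability.LatticeModels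
open Summit.QuantumFields.YangMills.Theorems.NPointIsotropy.Negative (E4)
open Summit.QuantumFields.YangMills.Theorems.CurvatureBoostCovariance.Negative
  (OSPackage Translations Hypercubic EightFrameRP PlanarCone Tie Gaps W1)
open Summit.QuantumFields.YangMills.Theorems.CurvatureSandwichBound.Negative
  (SandwichBound SandwichRows IsQuarterTurnFrame)

/-! ## The Yang–Mills input (the bet): chain growth at the pair scale, `e₀` frame -/

/-- **Stub (CG-axis) — CHAIN GROWTH AT THE PAIR SCALE, `e₀` FRAME (THE YANG–MILLS INPUT; difficulty XL).**
Unchanged from v3 (registered); equivalent to the `e₀` row of the crux (`sandwich_of_chainGrowth` /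
`chainGrowthAxis_of_crux`).  Its `N = 1`, `n = 0` corner is the vacuum row (kernel triple, `μ₀ = 4 − η/2`); its
`N = 2`, `n = 0` corner is a pair-scale UV bound on the vacuum four-point function of the Wilson limit. -/
theorem stub_chainGrowthAxis :
    ∀ (G : Type) [Group G] [TopologicalSpace G] [IsTopologicalGroup G] [CompactSpace G]
      [MeasurableSpace G] [BorelSpace G], IsCompactSimpleLieGroup G →
    ∀ (r : LatticeRep G) (sch : SpeciesScheme (YMSpecies G)) (S₁ : SchwingerFamily E4),
      W1 r sch S₁ → EightFrameRP S₁ → PlanarCone S₁ →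
      (∃ (K : E4 → ℝ) (C η : ℝ), 0 < η ∧ ContinuousOn K {x : E4 | x ≠ 0} ∧
        (∀ x : E4, x ≠ 0 → |K x| ≤ C * (1 + ‖x‖ ^ (η - 10))) ∧
        ∀ F : 𝓢((Fin 2 → E4), ℂ), IsOffDiagonal F →
          Integrable (fun x : Fin 2 → E4 => (K (x 0 - x 1) : ℂ) * F x) ∧
            S₁ 2 F = ∫ x : Fin 2 → E4, (K (x 0 - x 1) : ℂ) * F x) →
      OSReconstructionNoE1 S₁.toLabelled →
      ∃ μ C : ℝ, μ < 4 ∧ 0 ≤ C ∧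
        ∀ (u v : ℝ), 0 < u → 0 < v → u ≤ 1 → v ≤ 1 →
          ∀ (f₁ : 𝓢((Fin 1 → E4), ℂ)) (g hh : ℝ × ℝ → ℂ) (Mg Mh Mh' : ℝ),
            (∀ x : Fin 1 → E4, f₁ x = g (x 0 0, x 0 1) * hh (x 0 2, x 0 3)) →
            (∀ p : ℝ × ℝ, g p ≠ 0 → u ≤ p.1 ∧ p.1 ≤ 2 * u) →
            Integrable g → (∫ p, ‖g p‖) ≤ Mg → Integrable hh → (∫ p, ‖hh p‖) ≤ Mh →
            (∀ p, ‖hh p‖ ≤ Mh') →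
          ∀ (n : ℕ) (W : 𝓢((Fin n → E4), ℂ)), IsTimeOrdered W →
            IsTimeOrdered (f₁.appendTensor (translateMulti ((2 * u + v) • EuclideanSpace.single 0 1) W)) →
          ∀ (P : (Σ m : ℕ, 𝓢((Fin m → E4), ℂ)) → (Σ m : ℕ, 𝓢((Fin m → E4), ℂ))),
            (P = fun Gσ => ⟨1 + (1 + Gσ.1), translateMulti ((2 * u + v) • EuclideanSpace.single 0 1)
              ((osAdjoint f₁).appendTensor
                (f₁.appendTensor (translateMulti ((2 * u + v) • EuclideanSpace.single 0 1) Gσ.2)))⟩) →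
          ∀ N : ℕ,
            (S₁ (n + (P^[N] ⟨n, W⟩).1) ((osAdjoint W).appendTensor (P^[N] ⟨n, W⟩).2)).re ≤
              (S₁ (n + n) ((osAdjoint W).appendTensor W)).re *
                (C * Mg * (Mh + Mh') * (u ^ (-μ) + v ^ (-μ))) ^ (2 * N) := by
  sorry

/-! ## The model-blind frame-transfer stubs (wave 2) -/

/-- **Stub (GW) — GENERAL WINDOWS from the axis row (model-blind, pure bookkeeping over the OS space).**
If the sandwich bound holds for insertions windowed in `[u, 2u]` in front of states at `2u + v`
(`SandwichBound S h μ C`, `0 ≤ μ ≤ 4`, `0 ≤ C`), then for EVERY window `[a, a + ℓ]` (any length `ℓ ≥ 0`, left gap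
`0 < a ≤ 1`) and every right gap `0 < γ ≤ 1` the insertion `f₁ = g ⊗ hh` in front of a state at time `a + ℓ + γ` is
bounded by `64·C·Mg·(Mh+Mh')·(a^{-μ} + γ^{-μ})`: chop `[a, a+ℓ]` by a smooth partition of unity in time into
finitely many pieces `[c, d]` with `d ≤ 2c`, `d − c ≤ 1` (geometric then unit steps), `Σ ∫|g χ_j| = ∫|g|`; a piece with
`d ≤ 2` is `SandwichBound` at `u'' = d/2 ≥ a/2`, `v'' = min(a+ℓ+γ−d, 1) ≥ γ` (surplus gap absorbed by the contraction
`e^{-tH}`, `transfer_fieldVec`/`norm_transfer_le`); a piece with `d > 2` is first translated back by `d − 2`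
(`‖Ψ_{T_θ f ⊗ G}‖ = ‖e^{-θH} Ψ_{f ⊗ T_{-θ}G}‖ ≤ ‖Ψ_{f ⊗ T_{-θ} G}‖`) and bounded at `u'' = 1`; triangle inequality
(`fieldVec_add`) and `(a/2)^{-μ} ≤ 16 a^{-μ}`, `1 ≤ a^{-μ}`, `1 ≤ γ^{-μ}`. -/
theorem stub_generalWindow :
    ∀ (S : SchwingerFamily E4) (h : OSReconstructionNoE1 S.toLabelled) (μ C : ℝ),
      0 ≤ μ → μ ≤ 4 → 0 ≤ C → SandwichBound S h μ C →
      ∀ (a ℓ γ : ℝ), 0 < a → 0 ≤ ℓ → 0 < γ → a ≤ 1 → γ ≤ 1 →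
      ∀ (f₁ : 𝓢((Fin 1 → E4), ℂ)) (g hh : ℝ × ℝ → ℂ) (Mg Mh Mh' : ℝ),
        (∀ x : Fin 1 → E4, f₁ x = g (x 0 0, x 0 1) * hh (x 0 2, x 0 3)) →
        (∀ p : ℝ × ℝ, g p ≠ 0 → a ≤ p.1 ∧ p.1 ≤ a + ℓ) →
        Integrable g → (∫ p, ‖g p‖) ≤ Mg → Integrable hh → (∫ p, ‖hh p‖) ≤ Mh →
        (∀ p, ‖hh p‖ ≤ Mh') →
      ∀ (n : ℕ) (W : 𝓢((Fin n → E4), ℂ)) (hW : IsTimeOrdered W)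
        (hFW : IsTimeOrdered
          (f₁.appendTensor (translateMulti ((a + ℓ + γ) • EuclideanSpace.single 0 1) W))),
        ‖h.fieldVec (1 + n) (fun _ => ())
            (f₁.appendTensor (translateMulti ((a + ℓ + γ) • EuclideanSpace.single 0 1) W)) hFW‖ ≤
          64 * C * Mg * (Mh + Mh') * (a ^ (-μ) + γ ^ (-μ)) * ‖h.fieldVec n (fun _ => ()) W hW‖ :=
  -- LANDED p165820 (Theorems/IsotropyFromPowerCountingCurvatureSandwichBoundGeneralWindow.lean)
  Summit.QuantumFields.YangMills.Theorems.CurvatureSandwichBound.Sketch.stub_generalWindow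

/-- **Stub (TS) — ONE PERIOD OF THE TILTED CHAIN IN THE `e₀` FRAME (model-blind geometry + two general windows).**
`R` is the quarter-turn frame of the crux (`(Rx)₀ = (x₀+x₁)/√2`, `(Rx)₁ = (x₁−x₀)/√2`); `f₁ = g ⊗ hh` is a
45°-frame insertion, windowed in `[u, 2u]` in its own time and NARROW, `|x₁'| ≤ w`, `4w ≤ min(u,v)`; the tilted
period `Q⟨m, Y⟩ = ⟨2+m, T_{s·Re₀}(R·f₁† ⊗ (R·f₁ ⊗ T_{s·Re₀} Y))⟩` (`s = 2u+v`, `R·F := linActMulti R F`,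
`f₁† = osAdjoint f₁`) is the image under `R` of the 45°-frame chain step.  Read in true coordinates its two pieces
`T_{sRe₀}(R·f₁†)`, `T_{sRe₀}(R·f₁)` are product-form insertions `g̃ ⊗ hh` (`∫|g̃| = ∫|g|`, profile `hh` resp.
`conj ∘ hh`) with e₀-windows `[(v−w)/√2, (u+v+w)/√2]`, `[(3u+v−w)/√2, (4u+v+w)/√2]`, and the tail
`T_{2sRe₀} Y = T_{√2 s e₀} T_{-√2 s e₁} Y` starts after `√2 s`: so `Q⟨m,Y⟩` is e₀-time-ordered for every time-ordered
`Y`, and two applications of the general-window bound (hypothesis, constant `C'`; parameters `a = (v−w)/√2`,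
`γ = (u−w)/√2`, then `a = (u−w)/√2`, `γ = (v−w)/√2`, the e₁-translate being unitary `translate_fieldVec`) give
`‖Ψ_{Q⟨m,Y⟩}‖ ≤ (C'·Mg·(Mh+Mh')·16·(u^{-μ}+v^{-μ}))² ‖Ψ_Y‖` (`((v−w)/√2)^{-μ} ≤ (4√2/3)^4 v^{-μ} ≤ 13 v^{-μ}`). -/
theorem stub_tiltedStep :
    ∀ (S : SchwingerFamily E4) (h : OSReconstructionNoE1 S.toLabelled) (R : E4 ≃ₗᵢ[ℝ] E4),
      IsQuarterTurnFrame R →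
    ∀ (μ C' : ℝ), 0 ≤ μ → μ ≤ 4 → 0 ≤ C' →
      (∀ (a ℓ γ : ℝ), 0 < a → 0 ≤ ℓ → 0 < γ → a ≤ 1 → γ ≤ 1 →
        ∀ (f₁ : 𝓢((Fin 1 → E4), ℂ)) (g hh : ℝ × ℝ → ℂ) (Mg Mh Mh' : ℝ),
          (∀ x : Fin 1 → E4, f₁ x = g (x 0 0, x 0 1) * hh (x 0 2, x 0 3)) →
          (∀ p : ℝ × ℝ, g p ≠ 0 → a ≤ p.1 ∧ p.1 ≤ a + ℓ) →
          Integrable g → (∫ p, ‖g p‖) ≤ Mg → Integrable hh → (∫ p, ‖hh p‖) ≤ Mh →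
          (∀ p, ‖hh p‖ ≤ Mh') →
        ∀ (n : ℕ) (W : 𝓢((Fin n → E4), ℂ)) (hW : IsTimeOrdered W)
          (hFW : IsTimeOrdered
            (f₁.appendTensor (translateMulti ((a + ℓ + γ) • EuclideanSpace.single 0 1) W))),
          ‖h.fieldVec (1 + n) (fun _ => ())
              (f₁.appendTensor (translateMulti ((a + ℓ + γ) • EuclideanSpace.single 0 1) W)) hFW‖ ≤
            C' * Mg * (Mh + Mh') * (a ^ (-μ) + γ ^ (-μ)) * ‖h.fieldVec n (fun _ => ()) W hW‖) →
    ∀ (u v w : ℝ), 0 < u → 0 < v → 0 < w → u ≤ 1 → v ≤ 1 → 4 * w ≤ u → 4 * w ≤ v →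
    ∀ (f₁ : 𝓢((Fin 1 → E4), ℂ)) (g hh : ℝ × ℝ → ℂ) (Mg Mh Mh' : ℝ),
      (∀ x : Fin 1 → E4, f₁ x = g (x 0 0, x 0 1) * hh (x 0 2, x 0 3)) →
      (∀ p : ℝ × ℝ, g p ≠ 0 → u ≤ p.1 ∧ p.1 ≤ 2 * u ∧ |p.2| ≤ w) →
      Integrable g → (∫ p, ‖g p‖) ≤ Mg → Integrable hh → (∫ p, ‖hh p‖) ≤ Mh →
      (∀ p, ‖hh p‖ ≤ Mh') →
    ∀ (Q : (Σ m : ℕ, 𝓢((Fin m → E4), ℂ)) → (Σ m : ℕ, 𝓢((Fin m → E4), ℂ))),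
      (Q = fun Gσ => ⟨1 + (1 + Gσ.1),
        translateMulti ((2 * u + v) • R (EuclideanSpace.single 0 1))
          ((linActMulti R (osAdjoint f₁)).appendTensor
            ((linActMulti R f₁).appendTensor
              (translateMulti ((2 * u + v) • R (EuclideanSpace.single 0 1)) Gσ.2)))⟩) →
    ∀ (m : ℕ) (Y : 𝓢((Fin m → E4), ℂ)), IsTimeOrdered Y →
      IsTimeOrdered (Q ⟨m, Y⟩).2 ∧
        ∀ (hY : IsTimeOrdered Y) (hQY : IsTimeOrdered (Q ⟨m, Y⟩).2),
          ‖h.fieldVec (Q ⟨m, Y⟩).1 (fun _ => ()) (Q ⟨m, Y⟩).2 hQY‖ ≤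
            (C' * Mg * (Mh + Mh') * (16 * (u ^ (-μ) + v ^ (-μ)))) ^ 2 *
              ‖h.fieldVec m (fun _ => ()) Y hY‖ :=
  -- LANDED p166106 (Theorems/IsotropyFromPowerCountingCurvatureSandwichBoundTiltedStep.lean)
  Summit.QuantumFields.YangMills.Theorems.CurvatureSandwichBound.Sketch.stub_tiltedStep

/-- **Stub (TR) — READING A 45°-FRAME CHAIN WITH CONE-CHAIN ENDS IN THE `e₀` FRAME (model-blind bookkeeping).**
For the quarter-turn frame `R`, a narrow 45°-frame insertion `f₁` (only its support matters), the 45°-frame chain step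
`P` (the `P` of `stub_chainGrowthDiag`) and the tilted step `Q` (of `stub_tiltedStep`): if `G` is a STRICT CONE CHAIN
of the 45° frame (`|x₁'| < x₀'`, `|Δx₁'| < Δx₀'` on its support — the dense class of `stub_density`), then
(i) `R·G` is e₀-time-ordered (its slot times are `(x₀'+x₁')/√2`, increasing), (ii) `A := (θRθ)·G` is e₀-time-ordered
(slot times `(x₀'−x₁')/√2`), (iii) `osAdjoint A = R·(osAdjoint G)` (pointwise), (iv) `R` intertwines the two chain steps,
`⟨(P^N x).1, R·(P^N x).2⟩ = Q^N ⟨x.1, R·x.2⟩` (`R·T_a = T_{Ra}·R`, `R·(F ⊗ G) = R·F ⊗ R·G`), and hence (v) the 45°-frame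
chain moment with ends `G`, `G'` is an `e₀`-FRAME inner product:
`𝔖₁(R·(ΘG* ⊗ P^N G')) = ⟪Ψ_A, Ψ_{(Q^N ⟨m', R·G'⟩).2}⟫_h` (`inner_fieldVec_fieldVec`, `fieldVec_sigma_congr`). -/
theorem stub_tiltedChainReading :
    ∀ (S : SchwingerFamily E4) (h : OSReconstructionNoE1 S.toLabelled) (R : E4 ≃ₗᵢ[ℝ] E4),
      IsQuarterTurnFrame R →
    ∀ (u v : ℝ) (f₁ : 𝓢((Fin 1 → E4), ℂ))
      (P Q : (Σ m : ℕ, 𝓢((Fin m → E4), ℂ)) → (Σ m : ℕ, 𝓢((Fin m → E4), ℂ))),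
      (P = fun Gσ => ⟨1 + (1 + Gσ.1), translateMulti ((2 * u + v) • EuclideanSpace.single 0 1)
        ((osAdjoint f₁).appendTensor
          (f₁.appendTensor (translateMulti ((2 * u + v) • EuclideanSpace.single 0 1) Gσ.2)))⟩) →
      (Q = fun Gσ => ⟨1 + (1 + Gσ.1),
        translateMulti ((2 * u + v) • R (EuclideanSpace.single 0 1))
          ((linActMulti R (osAdjoint f₁)).appendTensor
            ((linActMulti R f₁).appendTensor
              (translateMulti ((2 * u + v) • R (EuclideanSpace.single 0 1)) Gσ.2)))⟩) →
    ∀ (m : ℕ) (G : 𝓢((Fin m → E4), ℂ)), IsTimeOrdered G →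
      tsupport (G : (Fin m → E4) → ℂ) ⊆
        {x | (∀ i, |x i 1| < x i 0) ∧ ∀ i j, i < j → |x j 1 - x i 1| < x j 0 - x i 0} →
      IsTimeOrdered (linActMulti R G) ∧
      IsTimeOrdered (linActMulti (((timeReflection 4).trans R).trans (timeReflection 4)) G) ∧
      osAdjoint (linActMulti (((timeReflection 4).trans R).trans (timeReflection 4)) G) =
        linActMulti R (osAdjoint G) ∧
      ∀ (m' : ℕ) (G' : 𝓢((Fin m' → E4), ℂ)), IsTimeOrdered G' →
        tsupport (G' : (Fin m' → E4) → ℂ) ⊆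
          {x | (∀ i, |x i 1| < x i 0) ∧ ∀ i j, i < j → |x j 1 - x i 1| < x j 0 - x i 0} →
        ∀ N : ℕ,
          (⟨(P^[N] ⟨m', G'⟩).1, linActMulti R (P^[N] ⟨m', G'⟩).2⟩ : Σ m : ℕ, 𝓢((Fin m → E4), ℂ)) =
            Q^[N] ⟨m', linActMulti R G'⟩ ∧
          ∀ (hA : IsTimeOrdered (linActMulti (((timeReflection 4).trans R).trans (timeReflection 4)) G))
            (hQ : IsTimeOrdered (Q^[N] ⟨m', linActMulti R G'⟩).2),
            S (m + (P^[N] ⟨m', G'⟩).1) (linActMulti R ((osAdjoint G).appendTensor (P^[N] ⟨m', G'⟩).2)) =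
              ⟪h.fieldVec m (fun _ => ())
                  (linActMulti (((timeReflection 4).trans R).trans (timeReflection 4)) G) hA,
                h.fieldVec (Q^[N] ⟨m', linActMulti R G'⟩).1 (fun _ => ())
                  (Q^[N] ⟨m', linActMulti R G'⟩).2 hQ⟫_ℂ :=
  -- LANDED p165469 (Theorems/IsotropyFromPowerCountingCurvatureSandwichBoundTiltedChainReading.lean)
  Summit.QuantumFields.YangMills.Theorems.CurvatureSandwichBound.Sketch.stub_tiltedChainReading

/-- **Stub (SE) — THE SUM ENGINE (model-blind: iterated Schwarz on finite combinations).**  For any one-species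
family `T` with an `e₀`-reconstruction `h`, a windowed insertion `f₁` (`[u,2u]`), `s = 2u+v`, the chain step `P`, and a
finite family of admissible generators `Gᵢ` with PAIRWISE chain-moment bounds
`|𝔖(ΘGᵢ* ⊗ P^N Gⱼ)| ≤ aᵢ aⱼ Λ^{2N}` (all `N`), the sandwich is bounded by `Λ` on the combination:
`‖Σ cᵢ Ψ_{f₁ ⊗ T_s Gᵢ}‖ ≤ Λ ‖Σ cᵢ Ψ_{Gᵢ}‖`.  Proof: `x = Σ cᵢΨ_{Gᵢ}`, `y = Σ cᵢΨ_{XGᵢ}`, `p_k = Σ cᵢ Ψ_{P^k Gᵢ}`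
(admissible by `adm_iterate'`); `‖y‖² = Re⟪x, p₁⟫` and `‖p_k‖² = Re⟪x, p_{2k}⟫` by bilinearity from
`stub_sandwichAdjoint` / `inner_P_symm` (two-ended iterate: `⟪Ψ_{P^a A}, Ψ_{P^b B}⟫ = ⟪Ψ_A, Ψ_{P^{a+b}B}⟫`), and
`Re⟪x, p_{2k}⟫ ≤ (Σ|cᵢ|aᵢ)² Λ^{4k}` by the pairwise bounds (`inner_fieldVec_fieldVec`); then `stub_iterSchwarz`. -/
theorem stub_sumEngine :
    ∀ (T : SchwingerFamily E4) (h : OSReconstructionNoE1 T.toLabelled) (u v : ℝ), 0 < u → 0 < v →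
    ∀ (f₁ : 𝓢((Fin 1 → E4), ℂ)),
      tsupport (f₁ : (Fin 1 → E4) → ℂ) ⊆ {x | u ≤ x 0 0 ∧ x 0 0 ≤ 2 * u} →
    ∀ (P : (Σ m : ℕ, 𝓢((Fin m → E4), ℂ)) → (Σ m : ℕ, 𝓢((Fin m → E4), ℂ))),
      (P = fun Gσ => ⟨1 + (1 + Gσ.1), translateMulti ((2 * u + v) • EuclideanSpace.single 0 1)
        ((osAdjoint f₁).appendTensor
          (f₁.appendTensor (translateMulti ((2 * u + v) • EuclideanSpace.single 0 1) Gσ.2)))⟩) →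
    ∀ (Λ : ℝ), 0 ≤ Λ →
    ∀ (k : ℕ) (G : Fin k → Σ m : ℕ, 𝓢((Fin m → E4), ℂ)) (hG : ∀ i, IsTimeOrdered (G i).2)
      (hXG : ∀ i, IsTimeOrdered
        (f₁.appendTensor (translateMulti ((2 * u + v) • EuclideanSpace.single 0 1) (G i).2)))
      (a : Fin k → ℝ),
      (∀ i, 0 ≤ a i) →
      (∀ (i j : Fin k) (N : ℕ),
        ‖T ((G i).1 + (P^[N] (G j)).1) ((osAdjoint (G i).2).appendTensor (P^[N] (G j)).2)‖ ≤
          a i * a j * Λ ^ (2 * N)) →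
    ∀ (c : Fin k → ℂ),
      ‖∑ i, c i • h.fieldVec (1 + (G i).1) (fun _ => ())
          (f₁.appendTensor (translateMulti ((2 * u + v) • EuclideanSpace.single 0 1) (G i).2)) (hXG i)‖ ≤
        Λ * ‖∑ i, c i • h.fieldVec (G i).1 (fun _ => ()) (G i).2 (hG i)‖ :=
  -- LANDED p165021 (Theorems/IsotropyFromPowerCountingCurvatureSandwichBoundSumEngine.lean)
  Summit.QuantumFields.YangMills.Theorems.CurvatureSandwichBound.Sketch.stub_sumEngine

/-- **Stub (DE) — DESCENT from a dense class of generators to all field vectors (model-blind).**  If the sandwich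
`X : Ψ_W ↦ Ψ_{f₁ ⊗ T_s W}` is bounded by `Λ` on all finite combinations of the field vectors of a class `𝒯` of
time-ordered test functions whose field vectors span a dense subspace of `h`, then `‖Ψ_{f₁ ⊗ T_s W}‖ ≤ Λ ‖Ψ_W‖` for
EVERY time-ordered `W`.  Proof: for a finite combination `Φ = Σ dⱼ Ψ_{Eⱼ}` of arbitrary generators,
`⟪Φ, Ψ_{f₁ ⊗ T_sW}⟫ = ⟪Φ♯, Ψ_W⟫` with `Φ♯ = Σ dⱼ Ψ_{T_s(f₁† ⊗ Eⱼ)}` (the adjoint identity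
`𝔖(ΘE* ⊗ f₁ ⊗ T_sW) = 𝔖(Θ(T_s(f₁†⊗E))* ⊗ W)`: `osAdjoint` reverses tensor factors, `osAdjoint_translateMulti`,
translation invariance on `⁰𝒮`, `schwinger_congr_cast`; cf. `sandwich_pointwise`); approximating `Ψ_W` by combinations
`x_k → Ψ_W` from the dense span and reading the identity backwards, `|⟪Φ, Ψ_{XW}⟫| = lim |⟪Φ, X x_k⟫| ≤ ‖Φ‖ Λ ‖Ψ_W‖`;
the `Φ` are dense (`denseRange_vec`). -/
theorem stub_descent :
    ∀ (T : SchwingerFamily E4) (h : OSReconstructionNoE1 T.toLabelled) (u v : ℝ), 0 < u → 0 < v →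
    ∀ (f₁ : 𝓢((Fin 1 → E4), ℂ)),
      tsupport (f₁ : (Fin 1 → E4) → ℂ) ⊆ {x | u ≤ x 0 0 ∧ x 0 0 ≤ 2 * u} →
    ∀ (Λ : ℝ), 0 ≤ Λ →
    ∀ (𝒯 : Set (Σ m : ℕ, 𝓢((Fin m → E4), ℂ))) (h𝒯 : ∀ x ∈ 𝒯, IsTimeOrdered x.2),
      Dense ((Submodule.span ℂ
        {ψ : h.Hilbert | ∃ (x : Σ m : ℕ, 𝓢((Fin m → E4), ℂ)) (hx : x ∈ 𝒯),
          ψ = h.fieldVec x.1 (fun _ => ()) x.2 (h𝒯 x hx)} : Submodule ℂ h.Hilbert) : Set h.Hilbert) →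
      (∀ (k : ℕ) (G : Fin k → Σ m : ℕ, 𝓢((Fin m → E4), ℂ)) (hG : ∀ i, G i ∈ 𝒯)
        (hXG : ∀ i, IsTimeOrdered
          (f₁.appendTensor (translateMulti ((2 * u + v) • EuclideanSpace.single 0 1) (G i).2)))
        (c : Fin k → ℂ),
        ‖∑ i, c i • h.fieldVec (1 + (G i).1) (fun _ => ())
            (f₁.appendTensor (translateMulti ((2 * u + v) • EuclideanSpace.single 0 1) (G i).2)) (hXG i)‖ ≤
          Λ * ‖∑ i, c i • h.fieldVec (G i).1 (fun _ => ()) (G i).2 (h𝒯 _ (hG i))‖) →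
    ∀ (n : ℕ) (W : 𝓢((Fin n → E4), ℂ)) (hW : IsTimeOrdered W)
      (hFW : IsTimeOrdered (f₁.appendTensor (translateMulti ((2 * u + v) • EuclideanSpace.single 0 1) W))),
      ‖h.fieldVec (1 + n) (fun _ => ())
          (f₁.appendTensor (translateMulti ((2 * u + v) • EuclideanSpace.single 0 1) W)) hFW‖ ≤
        Λ * ‖h.fieldVec n (fun _ => ()) W hW‖ :=
  -- LANDED p165092 (Theorems/IsotropyFromPowerCountingCurvatureSandwichBoundDescent.lean)
  Summit.QuantumFields.YangMills.Theorems.CurvatureSandwichBound.Sketch.stub_descent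

/-- **Stub (NR) — NARROW REDUCTION (model-blind `L¹` bookkeeping).**  If, for a one-species family `T` with an
`e₀`-reconstruction, the sandwich bound `‖Ψ_{f₁ ⊗ T_sW}‖ ≤ L·Mg·(Mh+Mh')·‖Ψ_W‖` holds for all windowed insertions
`f₁ = g ⊗ hh` whose `g` is NARROW AND CENTRED in `x₁` (`g p ≠ 0 → |p.2| ≤ w`), then it holds for ALL windowed
insertions with constant `2L`: centring by the unitary `x₁`-translation (`translate_fieldVec`, translation
invariance of `T` on `⁰𝒮`, `translateMulti` distributes over `appendTensor` and commutes with `T_s`), a smooth partition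
of unity `Σ_k χ_k(x₁) = 1` with `supp χ_k ⊆ [w(k−1), w(k+1)]`, `χ_k ≥ 0` (`Σ_k ∫|gχ_k| = ∫|g|`), finitely many `k`
once `g` has compact `x₁`-support (`fieldVec_add`, triangle inequality), and compact `x₁`-support is reached in the
limit (`exists_tsupport_subset_inter_closedBall_tendsto`-type truncation of `f₁`, `tendsto_fieldVec`,
`continuous_appendTensor`, `∫|g·cutoff| ≤ ∫|g|`). -/
theorem stub_narrowReduction :
    ∀ (T : SchwingerFamily E4) (h : OSReconstructionNoE1 T.toLabelled) (u v w L : ℝ),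
      0 < u → 0 < v → 0 < w → 0 ≤ L →
      (∀ (f₁ : 𝓢((Fin 1 → E4), ℂ)) (g hh : ℝ × ℝ → ℂ) (Mg Mh Mh' : ℝ),
        (∀ x : Fin 1 → E4, f₁ x = g (x 0 0, x 0 1) * hh (x 0 2, x 0 3)) →
        (∀ p : ℝ × ℝ, g p ≠ 0 → u ≤ p.1 ∧ p.1 ≤ 2 * u ∧ |p.2| ≤ w) →
        Integrable g → (∫ p, ‖g p‖) ≤ Mg → Integrable hh → (∫ p, ‖hh p‖) ≤ Mh →
        (∀ p, ‖hh p‖ ≤ Mh') →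
        ∀ (n : ℕ) (W : 𝓢((Fin n → E4), ℂ)) (hW : IsTimeOrdered W)
          (hFW : IsTimeOrdered (f₁.appendTensor (translateMulti ((2 * u + v) • EuclideanSpace.single 0 1) W))),
          ‖h.fieldVec (1 + n) (fun _ => ())
              (f₁.appendTensor (translateMulti ((2 * u + v) • EuclideanSpace.single 0 1) W)) hFW‖ ≤
            L * Mg * (Mh + Mh') * ‖h.fieldVec n (fun _ => ()) W hW‖) →
      ∀ (f₁ : 𝓢((Fin 1 → E4), ℂ)) (g hh : ℝ × ℝ → ℂ) (Mg Mh Mh' : ℝ),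
        (∀ x : Fin 1 → E4, f₁ x = g (x 0 0, x 0 1) * hh (x 0 2, x 0 3)) →
        (∀ p : ℝ × ℝ, g p ≠ 0 → u ≤ p.1 ∧ p.1 ≤ 2 * u) →
        Integrable g → (∫ p, ‖g p‖) ≤ Mg → Integrable hh → (∫ p, ‖hh p‖) ≤ Mh →
        (∀ p, ‖hh p‖ ≤ Mh') →
        ∀ (n : ℕ) (W : 𝓢((Fin n → E4), ℂ)) (hW : IsTimeOrdered W)
          (hFW : IsTimeOrdered (f₁.appendTensor (translateMulti ((2 * u + v) • EuclideanSpace.single 0 1) W))),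
          ‖h.fieldVec (1 + n) (fun _ => ())
              (f₁.appendTensor (translateMulti ((2 * u + v) • EuclideanSpace.single 0 1) W)) hFW‖ ≤
            2 * L * Mg * (Mh + Mh') * ‖h.fieldVec n (fun _ => ()) W hW‖ :=
  -- LANDED p166236 (Theorems/IsotropyFromPowerCountingCurvatureSandwichBoundNarrowReduction.lean)
  Summit.QuantumFields.YangMills.Theorems.CurvatureSandwichBound.Sketch.stub_narrowReduction

/-! ## The 45° input is a corollary (composition held by the lead) -/

/-- **Stub (CG-diag) — CHAIN GROWTH AT THE PAIR SCALE, `45°` FRAME — DERIVED** (unchanged registered signature):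
`stub_chainGrowthAxis` + engine ⇒ the axis rows `SandwichRows S₁`; the LANDED frame transfer
`sandwichRows_quarterTurn_of_sandwichRows` (p166596) ⇒ the rows of `S₁ ∘ R`; the converse engine `chainGrowth_of_sandwich`
for `S₁ ∘ R` ⇒ the normalised 45° chain growth (constant made nonnegative by `sandwichBound_mono_const`). -/
theorem stub_chainGrowthDiag :
    ∀ (G : Type) [Group G] [TopologicalSpace G] [IsTopologicalGroup G] [CompactSpace G]
      [MeasurableSpace G] [BorelSpace G], IsCompactSimpleLieGroup G →
    ∀ (r : LatticeRep G) (sch : SpeciesScheme (YMSpecies G)) (S₁ : SchwingerFamily E4),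
      W1 r sch S₁ → EightFrameRP S₁ → PlanarCone S₁ →
      (∃ (K : E4 → ℝ) (C η : ℝ), 0 < η ∧ ContinuousOn K {x : E4 | x ≠ 0} ∧
        (∀ x : E4, x ≠ 0 → |K x| ≤ C * (1 + ‖x‖ ^ (η - 10))) ∧
        ∀ F : 𝓢((Fin 2 → E4), ℂ), IsOffDiagonal F →
          Integrable (fun x : Fin 2 → E4 => (K (x 0 - x 1) : ℂ) * F x) ∧
            S₁ 2 F = ∫ x : Fin 2 → E4, (K (x 0 - x 1) : ℂ) * F x) →
      ∀ (R : E4 ≃ₗᵢ[ℝ] E4),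
        (∀ x : E4, R x 0 = Real.cos (Real.pi / 4) * x 0 + Real.sin (Real.pi / 4) * x 1 ∧
          R x 1 = -Real.sin (Real.pi / 4) * x 0 + Real.cos (Real.pi / 4) * x 1 ∧
          R x 2 = x 2 ∧ R x 3 = x 3) →
      OSReconstructionNoE1 (SchwingerFamily.toLabelled (fun n => (S₁ n).comp (linActMulti R))) →
      ∃ μ C : ℝ, μ < 4 ∧ 0 ≤ C ∧
        ∀ (u v : ℝ), 0 < u → 0 < v → u ≤ 1 → v ≤ 1 →
          ∀ (f₁ : 𝓢((Fin 1 → E4), ℂ)) (g hh : ℝ × ℝ → ℂ) (Mg Mh Mh' : ℝ),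
            (∀ x : Fin 1 → E4, f₁ x = g (x 0 0, x 0 1) * hh (x 0 2, x 0 3)) →
            (∀ p : ℝ × ℝ, g p ≠ 0 → u ≤ p.1 ∧ p.1 ≤ 2 * u) →
            Integrable g → (∫ p, ‖g p‖) ≤ Mg → Integrable hh → (∫ p, ‖hh p‖) ≤ Mh →
            (∀ p, ‖hh p‖ ≤ Mh') →
          ∀ (n : ℕ) (W : 𝓢((Fin n → E4), ℂ)), IsTimeOrdered W →
            IsTimeOrdered (f₁.appendTensor (translateMulti ((2 * u + v) • EuclideanSpace.single 0 1) W)) →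
          ∀ (P : (Σ m : ℕ, 𝓢((Fin m → E4), ℂ)) → (Σ m : ℕ, 𝓢((Fin m → E4), ℂ))),
            (P = fun Gσ => ⟨1 + (1 + Gσ.1), translateMulti ((2 * u + v) • EuclideanSpace.single 0 1)
              ((osAdjoint f₁).appendTensor
                (f₁.appendTensor (translateMulti ((2 * u + v) • EuclideanSpace.single 0 1) Gσ.2)))⟩) →
          ∀ N : ℕ,
            (S₁ (n + (P^[N] ⟨n, W⟩).1)
              (linActMulti R ((osAdjoint W).appendTensor (P^[N] ⟨n, W⟩).2))).re ≤
              (S₁ (n + n) (linActMulti R ((osAdjoint W).appendTensor W))).re *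
                (C * Mg * (Mh + Mh') * (u ^ (-μ) + v ^ (-μ))) ^ (2 * N) := by
  -- COMPOSITION (lead c1): axis input ⇒ axis rows (engine) ⇒ 45° rows (landed frame transfer
  -- `sandwichRows_quarterTurn_of_sandwichRows`) ⇒ normalised 45° chain growth (converse engine).
  intro G _ _ _ _ _ _ hG r sch S₁ hW1 h8 hC hK R hR h'
  have hrows : SandwichRows S₁ := by
    intro h₀
    obtain ⟨μ, C, hμ, hC0, hrow⟩ := stub_chainGrowthAxis G hG r sch S₁ hW1 h8 hC hK h₀
    refine ⟨μ, C, hμ, ?_⟩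
    intro u v hu hv hu1 hv1 f₁ g hh Mg Mh Mh' hf₁ hg hgi hMg hhi hMh hMh' n W hW hFW
    have hCW := hrow u v hu hv hu1 hv1 f₁ g hh Mg Mh Mh' hf₁ hg hgi hMg hhi hMh hMh' n W hW hFW _ rfl
    exact Summit.QuantumFields.YangMills.Theorems.CurvatureSandwichBound.Sketch.sandwich_of_chainGrowth S₁ h₀ u v
      hu hv f₁ (Summit.QuantumFields.YangMills.Theorems.CurvatureSandwichBound.Sketch.tsupport_subset_window hf₁ hg) _
      (Summit.QuantumFields.YangMills.Theorems.CurvatureSandwichBound.Sketch.pairScale_nonneg hC0 hu hv hMg hMh hMh')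
      W hW hFW _
      ((Summit.QuantumFields.YangMills.Theorems.CurvatureSandwichBound.Sketch.re_pairing_self_eq_norm_sq S₁ h₀ W
        hW).symm ▸ sq_nonneg _) _ rfl hCW
  obtain ⟨μ, C₀, hμ4, hSB⟩ :=
    Summit.QuantumFields.YangMills.Theorems.CurvatureSandwichBound.Sketch.sandwichRows_quarterTurn_of_sandwichRows S₁
      hW1.2.1 hW1.2.2.1 hrows R hR h'
  refine ⟨μ, max C₀ 0, hμ4, le_max_right _ _, ?_⟩
  intro u v hu hv hu1 hv1 f₁ g hh Mg Mh Mh' hf₁ hg hgi hMg hhi hMh hMh' n W hW hFW P hP N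
  have hSB' := Summit.QuantumFields.YangMills.Theorems.CurvatureSandwichBound.Sketch.sandwichBound_mono_const hSB
    (le_max_left C₀ 0)
  have hΛ := Summit.QuantumFields.YangMills.Theorems.CurvatureSandwichBound.Sketch.pairScale_nonneg (μ := μ)
    (le_max_right C₀ 0) hu hv hMg hMh hMh'
  have key := Summit.QuantumFields.YangMills.Theorems.CurvatureSandwichBound.Sketch.chainGrowth_of_sandwich
    (fun m => (S₁ m).comp (linActMulti R)) h' u v hu hv f₁
    (Summit.QuantumFields.YangMills.Theorems.CurvatureSandwichBound.Sketch.tsupport_subset_window hf₁ hg) _ hΛ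
    (fun m Gm hGm hXGm => hSB' u v hu hv hu1 hv1 f₁ g hh Mg Mh Mh' hf₁ hg hgi hMg hhi hMh hMh' m Gm hGm hXGm)
    P hP W hW hFW N
  rw [← Summit.QuantumFields.YangMills.Theorems.CurvatureSandwichBound.Sketch.re_pairing_self_eq_norm_sq
    (fun m => (S₁ m).comp (linActMulti R)) h' W hW] at key
  exact key

/-! ## The crux by name -/

/-- **Composition (one line over the landed closing recipe)**: the axis input and its 45° corollary give
`CurvatureSandwichBound` BY NAME (`curvatureSandwichBound_of_chainGrowth`, p146704). -/
theorem CurvatureSandwichBound_of :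
    Summit.QuantumFields.YangMills.Theses.IsotropyFromPowerCounting.CurvatureSandwichBound :=
  Summit.QuantumFields.YangMills.Theorems.CurvatureSandwichBound.Sketch.curvatureSandwichBound_of_chainGrowth
    stub_chainGrowthAxis stub_chainGrowthDiag

end Summit.QuantumFields.YangMills.Cruxes.CurvatureSandwichBound.Sketch

end
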